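import Literature.NumberTheory.ComplexMultiplication.CMOrderPEquivalenceLocalIsomorphism
import Literature.NumberTheory.ComplexMultiplication.CMOrderPEquivalenceLocalColon
import Literature.NumberTheory.ComplexMultiplication.CMOrderLocallyPrincipal
import HarnessLib

/-!
# `𝔭`-equivalent ideals have the same local multiplicator ring — `W̄_𝔭(R)` is well defined — and the unit class of
# `W_𝔭(R)`: `I` is `𝔭`-equivalent to `R` iff `I_𝔭` is principal (MARSEGLIA 2025 PROP. 3.2, closing formulas under (4))

Family `hodge`, lane `lit-hodgefound` (Track 2 foundations library; seat p15, row g26-#20), topic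
`Literature/NumberTheory/ComplexMultiplication`, namespace `Literature.NumberTheory.ComplexMultiplication.CMTypeLattice` (the
order `𝔯 = endOrder (M_μ)`, where `𝔭`-equivalence `1 ∈ (I:J)(J:I) + 𝔭` is local isomorphism `I_𝔭 = x·J_𝔭`,
`CMOrderPEquivalenceLocalIsomorphism`; the closing formulas from `I_𝔭 = x·J_𝔭` are in `CMOrderPEquivalenceLocalColon`).
THEOREMS ONLY: no definition, no instance, no named fact (net Literature debt `0`).  `R_𝔭 = Localization.subalgebra.ofField
K 𝔭.primeCompl _`, `N_𝔭 = span R_𝔭 ↑N`, `(I:J) = I / J`.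

## Source, VERBATIM

S. Marseglia, *Local isomorphism classes of fractional ideals of orders in étale algebras*, J. Algebra 673 (2025) 77–102
[Marseglia2025LocalIsomorphism] (arXiv:2311.18571, held `paper:arxiv-2311.18571`, chunks p0006–p0007): "Proposition 3.2.
… (4) `1 ∈ (I:J)(J:I) + 𝔭`. If any of the above holds, then we have `(I:I)_𝔭 = (J:J)_𝔭`, `(I:J)_𝔭 = α(I:I)_𝔭` and
`(J:I)_𝔭 = (1/α)(I:I)_𝔭`, with `α` as in (2). … For an order `R`, … let `W_𝔭(R)` be the set of `𝔭`-equivalence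
classes of fractional `R`-ideals [and] `W̄_𝔭(R)` be the set of `𝔭`-equivalence classes of fractional `R`-ideals `I`
with `(I:I)_𝔭 = R_𝔭`. … `W_𝔭(R)` … inherit the structure of commutative monoids, where the neutral element is the class
of `R`."

## What is formalised

* **`span_coe_div_self_eq_of_one_mem_add_coeIdeal`** (`𝔭`-equivalent ⟹ `(I:I)_𝔭 = (J:J)_𝔭`: the condition
  «`(I:I)_𝔭 = R_𝔭`» defining `W̄_𝔭(R)` depends only on the class), **`exists_span_coe_div_eq_of_one_mem_add_coeIdeal`**
  (`(I:J)_𝔭 = α(J:J)_𝔭`, `(J:I)_𝔭 = α⁻¹(J:J)_𝔭`), `span_coe_div_self_eq_span_one_of_one_mem_add_coeIdeal`,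
  **`one_mem_mul_div_add_coeIdeal_iff_exists_span_coe_eq`** (the neutral class: `I ~_𝔭 R ⟺ I_𝔭 = xR_𝔭`),
  **`isUnit_iff_forall_one_mem_mul_div_add_coeIdeal`** (`I` invertible ⟺ `I ~_𝔭 R` at every maximal `𝔭`).
-/

open scoped nonZeroDivisors NumberField
open Module FractionalIdeal NumberField

namespace Literature.NumberTheory.ComplexMultiplication

namespace CMTypeLattice

variable {K : Type} [Field K] [NumberField K]
variable {ι : Type} [Fintype ι] [DecidableEq ι] [Nonempty ι] (μ : Basis ι ℚ K)
variable [IsFractionRing (endOrder (Algebra.leftMulMatrix μ)) K]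

/-- **PROPOSITION 3.2, under (4): `𝔭`-equivalent ideals have the same local multiplicator ring, `(I:I)_𝔭 = (J:J)_𝔭`**
— so «`(I:I)_𝔭 = R_𝔭`», the condition cutting out `W̄_𝔭(R) ⊆ W_𝔭(R)`, is a class invariant.
[cite: Marseglia2025LocalIsomorphism, §3 Prop. 3.2 (closing formulas) and the definition of `W̄_𝔭(R)`, pp. 6–7] -/
theorem span_coe_div_self_eq_of_one_mem_add_coeIdeal {I J : FractionalIdeal (endOrder (Algebra.leftMulMatrix μ))⁰ K}
    (hI : I ≠ 0) (hJ : J ≠ 0) (𝔭 : Ideal (endOrder (Algebra.leftMulMatrix μ))) [𝔭.IsMaximal]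
    (h : (1 : K) ∈ I / J * (J / I) + (𝔭 : FractionalIdeal (endOrder (Algebra.leftMulMatrix μ))⁰ K)) :
    Submodule.span (Localization.subalgebra.ofField K 𝔭.primeCompl 𝔭.primeCompl_le_nonZeroDivisors)
        ((I / I : FractionalIdeal (endOrder (Algebra.leftMulMatrix μ))⁰ K) : Set K) =
      Submodule.span (Localization.subalgebra.ofField K 𝔭.primeCompl 𝔭.primeCompl_le_nonZeroDivisors)
        ((J / J : FractionalIdeal (endOrder (Algebra.leftMulMatrix μ))⁰ K) : Set K) := by
  haveI := isNoetherianRing_endOrder (Algebra.leftMulMatrix μ)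
  obtain ⟨x, -, hx⟩ := exists_ne_zero_span_coe_eq_of_one_mem_add_coeIdeal μ hI hJ 𝔭 h
  exact NumberRing.span_coe_div_self_eq_of_span_coe_eq hI hJ 𝔭 hx

/-- **PROPOSITION 3.2, under (4): `(I:J)_𝔭 = α(J:J)_𝔭` and `(J:I)_𝔭 = α⁻¹(J:J)_𝔭` for some `α ∈ K^*` with
`I_𝔭 = αJ_𝔭`.** [cite: Marseglia2025LocalIsomorphism, §3 Prop. 3.2 (closing formulas), p. 6] -/
theorem exists_span_coe_div_eq_of_one_mem_add_coeIdeal {I J : FractionalIdeal (endOrder (Algebra.leftMulMatrix μ))⁰ K}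
    (hI : I ≠ 0) (hJ : J ≠ 0) (𝔭 : Ideal (endOrder (Algebra.leftMulMatrix μ))) [𝔭.IsMaximal]
    (h : (1 : K) ∈ I / J * (J / I) + (𝔭 : FractionalIdeal (endOrder (Algebra.leftMulMatrix μ))⁰ K)) :
    ∃ x : K, x ≠ 0 ∧
      Submodule.span (Localization.subalgebra.ofField K 𝔭.primeCompl 𝔭.primeCompl_le_nonZeroDivisors) (I : Set K) =
        Submodule.span (Localization.subalgebra.ofField K 𝔭.primeCompl 𝔭.primeCompl_le_nonZeroDivisors) {x} *
          Submodule.span (Localization.subalgebra.ofField K 𝔭.primeCompl 𝔭.primeCompl_le_nonZeroDivisors) (J : Set K) ∧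
      Submodule.span (Localization.subalgebra.ofField K 𝔭.primeCompl 𝔭.primeCompl_le_nonZeroDivisors)
          ((I / J : FractionalIdeal (endOrder (Algebra.leftMulMatrix μ))⁰ K) : Set K) =
        Submodule.span (Localization.subalgebra.ofField K 𝔭.primeCompl 𝔭.primeCompl_le_nonZeroDivisors) {x} *
          Submodule.span (Localization.subalgebra.ofField K 𝔭.primeCompl 𝔭.primeCompl_le_nonZeroDivisors)
            ((J / J : FractionalIdeal (endOrder (Algebra.leftMulMatrix μ))⁰ K) : Set K) ∧
      Submodule.span (Localization.subalgebra.ofField K 𝔭.primeCompl 𝔭.primeCompl_le_nonZeroDivisors)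
          ((J / I : FractionalIdeal (endOrder (Algebra.leftMulMatrix μ))⁰ K) : Set K) =
        Submodule.span (Localization.subalgebra.ofField K 𝔭.primeCompl 𝔭.primeCompl_le_nonZeroDivisors) {x⁻¹} *
          Submodule.span (Localization.subalgebra.ofField K 𝔭.primeCompl 𝔭.primeCompl_le_nonZeroDivisors)
            ((J / J : FractionalIdeal (endOrder (Algebra.leftMulMatrix μ))⁰ K) : Set K) := by
  haveI := isNoetherianRing_endOrder (Algebra.leftMulMatrix μ)
  obtain ⟨x, hx0, hx⟩ := exists_ne_zero_span_coe_eq_of_one_mem_add_coeIdeal μ hI hJ 𝔭 h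
  exact ⟨x, hx0, hx, NumberRing.span_coe_div_eq_span_singleton_mul_of_span_coe_eq hI hJ 𝔭 hx,
    NumberRing.span_coe_div_eq_span_singleton_inv_mul_of_span_coe_eq hI hJ 𝔭 hx⟩

/-- **`W̄_𝔭(R)` is well defined: if `I ~_𝔭 J` and `(I:I)_𝔭 = R_𝔭` then `(J:J)_𝔭 = R_𝔭`.**
[cite: Marseglia2025LocalIsomorphism, §3 (definition of `W̄_𝔭(R)`), p. 7] -/
theorem span_coe_div_self_eq_span_one_of_one_mem_add_coeIdeal {I J : FractionalIdeal (endOrder (Algebra.leftMulMatrix μ))⁰ K}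
    (hI : I ≠ 0) (hJ : J ≠ 0) (𝔭 : Ideal (endOrder (Algebra.leftMulMatrix μ))) [𝔭.IsMaximal]
    (h : (1 : K) ∈ I / J * (J / I) + (𝔭 : FractionalIdeal (endOrder (Algebra.leftMulMatrix μ))⁰ K))
    (hII : Submodule.span (Localization.subalgebra.ofField K 𝔭.primeCompl 𝔭.primeCompl_le_nonZeroDivisors)
        ((I / I : FractionalIdeal (endOrder (Algebra.leftMulMatrix μ))⁰ K) : Set K) =
      Submodule.span (Localization.subalgebra.ofField K 𝔭.primeCompl 𝔭.primeCompl_le_nonZeroDivisors) {1}) :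
    Submodule.span (Localization.subalgebra.ofField K 𝔭.primeCompl 𝔭.primeCompl_le_nonZeroDivisors)
        ((J / J : FractionalIdeal (endOrder (Algebra.leftMulMatrix μ))⁰ K) : Set K) =
      Submodule.span (Localization.subalgebra.ofField K 𝔭.primeCompl 𝔭.primeCompl_le_nonZeroDivisors) {1} := by
  rw [← span_coe_div_self_eq_of_one_mem_add_coeIdeal μ hI hJ 𝔭 h, hII]

/-- **The neutral class of `W_𝔭(R)`: `I` is `𝔭`-equivalent to `R` iff `I_𝔭` is principal, `I_𝔭 = xR_𝔭`**
(«the neutral element is the class of `R`»; Prop. 3.2 (4) ⟺ (2) with `J = R`). [cite: Marseglia2025LocalIsomorphism, §3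
Prop. 3.2 and the paragraph on `W_𝔭(R)`, pp. 6–7] -/
theorem one_mem_mul_div_add_coeIdeal_iff_exists_span_coe_eq {I : FractionalIdeal (endOrder (Algebra.leftMulMatrix μ))⁰ K}
    (hI : I ≠ 0) (𝔭 : Ideal (endOrder (Algebra.leftMulMatrix μ))) [𝔭.IsMaximal] :
    (1 : K) ∈ I * (1 / I) + (𝔭 : FractionalIdeal (endOrder (Algebra.leftMulMatrix μ))⁰ K) ↔
      ∃ x : K, x ≠ 0 ∧
        Submodule.span (Localization.subalgebra.ofField K 𝔭.primeCompl 𝔭.primeCompl_le_nonZeroDivisors) (I : Set K) =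
          Submodule.span (Localization.subalgebra.ofField K 𝔭.primeCompl 𝔭.primeCompl_le_nonZeroDivisors) {x} := by
  have h10 : (1 : FractionalIdeal (endOrder (Algebra.leftMulMatrix μ))⁰ K) ≠ 0 := one_ne_zero
  have key := exists_ne_zero_span_coe_eq_iff_one_mem_add_coeIdeal μ hI h10 𝔭
  rw [FractionalIdeal.div_one] at key
  rw [← key]
  refine exists_congr fun x ↦ and_congr_right fun _ ↦ ?_
  rw [NumberRing.span_coe_one, ← Submodule.one_eq_span, mul_one]

/-- **`I` is invertible iff `I` is `𝔭`-equivalent to `R` at every maximal `𝔭`** (Prop. 3.2 with `J = R` and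
«invertible ⟺ locally principal», `CMOrderLocallyPrincipal`). [cite: Marseglia2025LocalIsomorphism, §2 Lemma 2.2 (1)
(«`I` is invertible if and only if `I` is locally principal») and §3 Prop. 3.2, pp. 5–6] -/
theorem isUnit_iff_forall_one_mem_mul_div_add_coeIdeal {I : FractionalIdeal (endOrder (Algebra.leftMulMatrix μ))⁰ K}
    (hI : I ≠ 0) :
    IsUnit I ↔ ∀ 𝔭 : MaximalSpectrum (endOrder (Algebra.leftMulMatrix μ)),
      (1 : K) ∈ I * (1 / I) + (𝔭.asIdeal : FractionalIdeal (endOrder (Algebra.leftMulMatrix μ))⁰ K) := by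
  rw [EndOrder.isUnit_iff_forall_isPrincipal_span hI]
  refine forall_congr' fun 𝔭 ↦ ?_
  haveI := 𝔭.isMaximal
  rw [one_mem_mul_div_add_coeIdeal_iff_exists_span_coe_eq μ hI 𝔭.asIdeal]
  constructor
  · rintro ⟨x, hx⟩
    refine ⟨x, ?_, hx⟩
    rintro rfl
    haveI := 𝔭.isMaximal.isPrime
    obtain ⟨a, ha0, haI⟩ := exists_ne_zero_mem_isInteger hI
    have ha : algebraMap (endOrder (Algebra.leftMulMatrix μ)) K a ∈ Submodule.span
        (Localization.subalgebra.ofField K 𝔭.asIdeal.primeCompl 𝔭.asIdeal.primeCompl_le_nonZeroDivisors) (I : Set K) :=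
      Submodule.subset_span haI
    rw [hx, Submodule.span_singleton_eq_bot.2 rfl] at ha
    exact ha0 (IsFractionRing.injective (endOrder (Algebra.leftMulMatrix μ)) K
      (((Submodule.mem_bot _).1 ha).trans (map_zero _).symm))
  · rintro ⟨x, -, hx⟩
    exact ⟨x, hx⟩

end CMTypeLattice

end Literature.NumberTheory.ComplexMultiplication
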